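import Literature.FieldTheory.AlgClosed.PuiseuxAtInfinityNormalForm
import Literature.Analysis.Complex.AnalyticRootSystems
import Mathlib.FieldTheory.IsAlgClosed.Basic
import Mathlib.Analysis.Complex.Polynomial.Basic
import HarnessLib

/-!
# Convergent Puiseux expansions at infinity of a plane algebraic curve

Let `Q ∈ ℂ[u][Y]` be irreducible of `Y`-degree `d ≥ 1`. Then there are a ramification index
`e ≥ 1`, an exponent `M ≥ 0`, a radius `r > 0` and `d` functions `y₁, …, y_d` holomorphic on
`|t| < r` such that for `0 < |t| < r` the roots of `Q(t^{-e}, ·)` are exactly the `d` values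
`yᵢ(t) t^{-M}`; consequently every solution `(u, v)` of `Q(u, v) = 0` with `|u| > r^{-e}` is of the
form `u = t^{-e}`, `v = yᵢ(t) t^{-M}` with `0 < |t| < r` (`exists_branches_at_infinity`): all
points of the curve near `u = ∞` lie on finitely many convergent Laurent–Puiseux branches.

Proof: the formal normal form `Q'(t, Y) = c(t) ∏ᵢ (Y - rᵢ(t))`, `c(0) ≠ 0`, `rᵢ ∈ ℂ⟦t⟧`
pairwise distinct, `Q'(t, t^M v) = 0 ↔ Q(t^{-e}, v) = 0`
(`Literature.FieldTheory.AlgClosed.PuiseuxInfinity.exists_formal_normal_form_at_infinity`,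
Newton–Puiseux) has simple formal roots, which are therefore Taylor series of holomorphic roots
(`Literature.Analysis.Complex.FormalRoot.exists_local_roots_of_taylor_factorization`, implicit
function theorem). [folklore]

## References

* E. Brieskorn, H. Knörrer, *Plane Algebraic Curves*, Birkhäuser 1986, §8.3 (convergence of
  Puiseux expansions; branches at infinity). [folklore]
* J.-P. Serre, *Local Fields*, GTM 67, Ch. IV §2, Prop. 8 and exercise (formal case).
-/

noncomputable section

open Complex Filter Topology Set Metric Finset Polynomial
open scoped Nat

namespace Literature.Analysis.Complex

namespace PuiseuxInfinity

open Literature.Analysis.Complex.FormalRoot (exists_local_roots_of_taylor_factorization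
  taylor_polynomial)
open Literature.FieldTheory.AlgClosed.PuiseuxInfinity (exists_formal_normal_form_at_infinity)

/-- The Taylor series of `f : ℂ → ℂ` at `0`, as a formal power series (local notation, as in
`AndreCriterionAnalyticProofs`). -/
local notation3 "𝓣[" f "]" =>
  (PowerSeries.mk fun n => ((Nat.factorial n : ℂ)⁻¹ * iteratedDeriv n f 0) : PowerSeries ℂ)

/-- **Convergent Puiseux branches at infinity.** For `Q ∈ ℂ[u][Y]` irreducible of `Y`-degree
`d ≥ 1` there are `e ≥ 1`, `M`, `r > 0` and `y₁, …, y_d` holomorphic on `|t| < r` such that: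
for `0 < |t| < r` the roots of `Q(t^{-e}, ·)` are exactly the values `yᵢ(t)/t^M`; and every
solution of `Q(u, v) = 0` with `|u| > (r⁻¹)^e` has the form `u⁻¹ = tᵉ`, `v = yᵢ(t)/t^M` with
`0 < |t| < r`. [folklore] -/
theorem exists_branches_at_infinity (Q : Polynomial ℂ[X]) (hirr : Irreducible Q)
    (hd : 0 < Q.natDegree) :
    ∃ (e : ℕ) (_ : 0 < e) (M : ℕ) (r : ℝ) (_ : 0 < r) (y : Fin Q.natDegree → ℂ → ℂ),
      (∀ i, DifferentiableOn ℂ (y i) (ball 0 r)) ∧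
      (∀ t : ℂ, t ≠ 0 → ‖t‖ < r → ∀ v : ℂ,
        ((Q.map (evalRingHom (t ^ e)⁻¹)).eval v = 0 ↔ ∃ i, v = y i t / t ^ M)) ∧
      ∀ u v : ℂ, r⁻¹ ^ e < ‖u‖ → (Q.map (evalRingHom u)).eval v = 0 →
        ∃ i, ∃ t : ℂ, t ≠ 0 ∧ ‖t‖ < r ∧ t ^ e = u⁻¹ ∧ v = y i t / t ^ M := by
  classical
  set d : ℕ := Q.natDegree with hd_def
  obtain ⟨e, he, M, Q', c, rt, hdeg', htop, hc0, hinj, hfact, heval⟩ :=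
    exists_formal_normal_form_at_infinity Q hirr hd
  haveI : Nonempty (Fin d) := ⟨⟨0, hd⟩⟩
  set b : ℕ → ℂ → ℂ := fun n t => (Q'.coeff n).eval t with hb
  have hbd : ∀ n ∈ range (d + 1), DifferentiableOn ℂ (b n) (ball 0 1) := fun n _ =>
    (Polynomial.differentiable _).differentiableOn
  have hb0 : b d 0 ≠ 0 := by
    show (Q'.coeff d).eval 0 ≠ 0
    rw [htop]; exact hc0
  have hTb : ∀ n, 𝓣[b n] = ((Q'.coeff n : ℂ[X]) : PowerSeries ℂ) := fun n =>
    taylor_polynomial (Q'.coeff n)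
  have hfact' : ∀ n ∈ range (d + 1), 𝓣[b n] =
      (Polynomial.C 𝓣[b d] * ∏ i, (Polynomial.X - Polynomial.C (rt i))).coeff n := by
    intro n _
    rw [hTb, hTb, htop]
    exact hfact n
  obtain ⟨ε, hε, -, y, hy, -, hfac⟩ :=
    exists_local_roots_of_taylor_factorization (ι := Fin d) (Fintype.card_fin d) one_pos hbd hb0
      hinj hfact'
  -- `c(t) ≠ 0` near `0`
  obtain ⟨δ, hδ, hcδ⟩ : ∃ δ > 0, ∀ t : ℂ, ‖t‖ < δ → c.eval t ≠ 0 := by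
    have hev : ∀ᶠ t in 𝓝 (0 : ℂ), c.eval t ≠ 0 :=
      (Polynomial.continuous c).continuousAt.eventually_ne hc0
    obtain ⟨δ, hδ, h⟩ := Metric.eventually_nhds_iff.1 hev
    exact ⟨δ, hδ, fun t ht => h (by simpa using ht)⟩
  set r : ℝ := min ε δ with hr
  have hr0 : 0 < r := lt_min hε hδ
  -- the factorisation of `Q'(t, ·)` for `|t| < r`
  have hQ't : ∀ t : ℂ, ‖t‖ < r → ∀ w : ℂ,
      (Q'.map (evalRingHom t)).eval w = c.eval t * ∏ i, (w - y i t) := by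
    intro t ht w
    have htε : t ∈ ball (0 : ℂ) ε := by
      rw [mem_ball_zero_iff]; exact ht.trans_le (min_le_left _ _)
    have h := hfac t htε
    have hsum : Q'.map (evalRingHom t) =
        ∑ n ∈ range (d + 1), Polynomial.C (b n t) * Polynomial.X ^ n := by
      conv_lhs => rw [as_sum_range_C_mul_X_pow' (Q'.map (evalRingHom t))
        (Nat.lt_succ_of_le ((natDegree_map_le).trans hdeg'))]
      refine Finset.sum_congr rfl fun n _ => ?_
      rw [coeff_map, coe_evalRingHom]
    have hbd' : b d t = c.eval t := by show (Q'.coeff d).eval t = c.eval t; rw [htop]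
    rw [hsum, h, hbd', eval_mul, eval_C, eval_prod]
    simp only [eval_sub, eval_X, eval_C]
  -- roots of `Q(t^{-e}, ·)` for `0 < |t| < r`
  have hroots : ∀ t : ℂ, t ≠ 0 → ‖t‖ < r → ∀ v : ℂ,
      ((Q.map (evalRingHom (t ^ e)⁻¹)).eval v = 0 ↔ ∃ i, v = y i t / t ^ M) := by
    intro t ht htr v
    rw [← heval t ht v, hQ't t htr, mul_eq_zero, or_iff_right (hcδ t (htr.trans_le (min_le_right _ _))),
      Finset.prod_eq_zero_iff]
    simp only [Finset.mem_univ, true_and, sub_eq_zero]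
    refine exists_congr fun i => ?_
    rw [eq_div_iff (pow_ne_zero M ht), mul_comm]
  refine ⟨e, he, M, r, hr0, y, fun i => (hy i).mono (ball_subset_ball (min_le_left _ _)), hroots,
    fun u v hu hQ => ?_⟩
  -- points with `|u| > r^{-e}`
  have hu0 : u ≠ 0 := by
    rintro rfl
    rw [norm_zero] at hu
    exact absurd hu (not_lt.2 (pow_nonneg (inv_nonneg.2 hr0.le) e))
  obtain ⟨t, htu⟩ := IsAlgClosed.exists_pow_nat_eq u⁻¹ he
  have ht0 : t ≠ 0 := by
    rintro rfl
    rw [zero_pow he.ne'] at htu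
    exact inv_ne_zero hu0 htu.symm
  have htr : ‖t‖ < r := by
    have h1 : ‖t‖ ^ e = ‖u‖⁻¹ := by rw [← norm_pow, htu, norm_inv]
    have h2 : ‖u‖⁻¹ < r ^ e := by
      rw [inv_pow] at hu
      exact inv_lt_of_inv_lt₀ (pow_pos hr0 e) hu
    exact lt_of_pow_lt_pow_left₀ e hr0.le (h1 ▸ h2)
  refine (hroots t ht0 htr v).1 ?_ |>.imp fun i hi => ⟨t, ht0, htr, htu, hi⟩
  rwa [htu, inv_inv]

end PuiseuxInfinity

end Literature.Analysis.Complex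

end
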